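import Literature.AlgebraicGeometry.ComplexMultiplication.CyclotomicFermatCMTypesLevelTwentyFour
import Literature.AlgebraicGeometry.ComplexMultiplication.CyclotomicFermatCMTypesEllipticFactorsCMFields
import HarnessLib

/-!
# Bauer–Coste–Itzykson–Ruelle §3.4 at the level `24`, the Koblitz–Rohrlich triples: which `H_{r,s,t}` occur, the `157` elliptic ones by
# their field (`48 ∕ 57 ∕ 40 ∕ 12` for `ℚ(√−6) ∕ ℚ(i) ∕ ℚ(√−3) ∕ ℚ(√−2)`), «`[L_{1,3,20}]^{24}`» on abelian varieties, the identity blocks of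
# the exceptional invariants `E₈`, `E₁₂`, `E₂₄` (at `24`: `H = {1,5,7,11}`, field `ℚ(√−6)`), and «`24` is the largest integer with `u² ≡ 1`»

Layer `Literature/AlgebraicGeometry/ComplexMultiplication`; sequel of `CyclotomicFermatCMTypesLevelTwentyFour` (this lane gen 42: for EVERY CM
type of `ℚ(ζ₂₄)` the residue stabiliser is `{1}` or one of the four groups `{1,5,7,11}`, `{1,5,13,17}`, `{1,7,13,19}`, `{1,11,17,19}`; the four
fixed fields `ℚ(√−6) = ℚ(ζ+ζ⁵+ζ⁷+ζ¹¹)`, `ℚ(i) = ℚ(ζ⁶)`, `ℚ(√−3) = ℚ(1+2ζ⁸)`, `ℚ(√−2) = ℚ(ζ³+ζ⁹)`; simple fourfold or `E⁴`; `A ∼ A'` iff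
`W = W'`) and of `CyclotomicFermatCMTypesEllipticFactorsCMFields` (gen 41: levels `8`, `12` and the COUNT `157 + 4·24` at `24`).  THIS FILE reads
the level-`24` results on the Koblitz–Rohrlich triples `(r, s, t)`, `0 < r, s, t < 24`, `r + s + t = 24` (the `253` «admissible triplets» of
BCIR's bookkeeping, non-primitive ones included).  THEOREMS ONLY (no definition, no named fact, no `sorry`; kernel `decide` over the `576`
pairs `(r, s) ∈ (ℤ/24)²` under `maxRecDepth 100000`, ≈ 20 s each, as in the sibling's `card_triples_twentyFour`).

THE SOURCE.  M. Bauer, A. Coste, C. Itzykson, P. Ruelle, J. Geom. Phys. **22** (1997) 134–189 (held `paper:arxiv-hep-th_9604104`, read first-hand):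
§3.4 p. 14 «every element of `ℤ₂₄*` has a square equal to `1` modulo `24` (`24` is the largest integer to have this property) … Finally for
`n = 24`, there are `24` triplets `(r,s,t)` such that their `H_{r,s,t}` is not a group, for instance `H_{1,3,20} = {1,5,11,17}`. The corresponding
`L_{r,s,t}` are all equal and their product is `[L_{1,3,20}]^{24}`, with `L_{1,3,20} ⊂ ℂ⁴` simple because `W_{1,3,20} = {1}`. Putting everything
together, one obtains … `F_{24} ∼ [ℂ⁴/L_{1,3,20}]^{24} ⊕ [product of 157 elliptic curves]`»; p. 15 «Let us finally observe that the weights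
involved in the exceptional `su(3)` modular invariants at height `n = 8, 12` and `24`, correspond to lattices which have all a maximal decomposition
in elliptic curves. Moreover, those pertaining to a given type I modular invariant have complex multiplication by the same CM field, namely
`ℚ(√−2)` for `n = 8` and `24`, and `ℚ(i)` for `n = 12`»; §4.3 pp. 23–24 «For `n₀ = 24`: the four triangles (of genus `11`) are `(1,1,22)`,
`(5,5,14)`, `(7,7,10)` and `(11,11,2)`. The exceptional invariant at height `24` is `E₂₄ = |χ_{(1,1,22)} + χ_{(5,5,14)} + χ_{(7,7,10)} + χ_{(11,11,2)}
+ all perm.|² + …`», «For `n₀ = 12`: the two triangles are `(1,1,10)` and `(5,5,2)` … `E₁₂ = |χ_{(1,1,10)} + χ_{(5,5,2)} + all perm.|² + …`»,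
«For `n₀ = 8`: there are two triangles, `(1,1,6)` and `(3,3,2)` … `E₈ = |χ_{(1,1,6)} + χ_{(3,3,2)}|² + …`», «the triangle `(1,7,16)` appearing in
the second block of `E₂₄`».

READING (as in the siblings).  `H_τ = fermatCMType 24 r s t` computed AT LEVEL `24` for the representative with `r + s + t = 24` (so `1 ∈ H_τ`);
at `24` it is either one of the four GROUPS of the prequel (then every realisation of `Φ_{H_τ}` is `∼ E⁴`, `E` elliptic with complex multiplication by
`𝓞_{K₁}`, `K₁` the quadratic field of the group) or one of the four unit translates `{1,5,11,17}`, `{1,5,7,13}`, `{1,7,11,19}`, `{1,13,17,19}` of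
`H_{1,3,20}` containing `1` (then every realisation is a SIMPLE fourfold, and all of these are isogenous).  The Jacobian `J(F_{24}) ∼ ∏ L_{r,s,t}`
itself is NOT constructed: «`157`», «`24`» are counts of triples by their `H` (BCIR's own bookkeeping), refined here by field.

KERNEL VS. PRINT (recorded, not adjudicated beyond the residue arithmetic).  The identity-block triangles of `E₂₄` printed on p. 23 —
`(1,1,22)`, `(5,5,14)`, `(7,7,10)`, `(11,11,2)` and their permutations — and `(1,7,16)` (p. 24) ALL have `H = {1,5,7,11}` (kernel), whose fixed
field is `ℚ(ζ+ζ⁵+ζ⁷+ζ¹¹) = ℚ(√−6)` and does NOT contain `√−2 = ζ³+ζ⁹` (prequel: `σ₅` negates it); more: NO primitive triple at level `24` has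
`H = {1,11,17,19}`, the only stabiliser with field `ℚ(√−2)` (the twelve triples with that `H` are the `3·(r',s',t')` with level-`8` set `{1,3}`).
So p. 15's «namely `ℚ(√−2)` for `n = 8` and `24`» agrees with the kernel at `n = 8` (`H_{1,1,6} = H_{3,3,2} = {1,3} ↦ ℚ(√−2)`) and at `n = 12`
(`H_{1,1,10} = H_{5,5,2} = {1,5} ↦ ℚ(i)`), while at `n = 24` the common field of the identity block is `ℚ(√−6)`; the qualitative statement («the
same CM field» within the block) holds.

## What is proved

* §0 (any `N ≥ 1`): **`forall_units_sq_eq_one_iff_dvd_twentyFour`** — every unit of `ℤ/N` squares to `1` iff `N ∣ 24` («`24` is the largest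
  integer to have this property»; `→`: if `5 ∣ N` a unit above `2 mod 5` has square `≠ 1`, else `5` is a unit and `N ∣ 24 = 5² − 1`; `←`: lift
  along `(ℤ/24)ˣ ↠ (ℤ/N)ˣ`).
* §1 THE TRIPLES MODULO `24` (namespace `…CyclotomicFermatCMType`; kernel): `fermatCMType_twentyFour_group_examples` (`H_{1,1,22} = H_{1,5,18} =
  {1,5,7,11}`, `H_{1,6,17} = H_{1,10,13} = {1,5,13,17}`, `H_{1,4,19} = H_{4,7,13} = {1,7,13,19}`, `H_{3,3,18} = H_{3,9,12} = {1,11,17,19}`),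
  `fermatCMType_twentyFour_simple_examples` (`H_{1,2,21} = {1,5,7,13}`, `H_{1,9,14} = {1,7,11,19}`, `H_{2,3,19} = {1,13,17,19}`; `H_{1,3,20}` is the
  sibling's), **`fermatCMType_twentyFour_mem_or_mem`** (EVERY admissible triple: `H_τ` is one of the four groups OR one of the four translates of
  `H_{1,3,20}` containing `1`), **`card_triples_twentyFour_by_field`** (`48 ∕ 57 ∕ 40 ∕ 12` triples with `H = {1,5,7,11} ∕ {1,5,13,17} ∕ {1,7,13,19} ∕
  {1,11,17,19}`: BCIR's `157 = 48 + 57 + 40 + 12` elliptic curves by CM field `ℚ(√−6) ∕ ℚ(i) ∕ ℚ(√−3) ∕ ℚ(√−2)`),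
  **`card_primitive_triples_twentyFour_by_field`** (among the PRIMITIVE ones, `gcd(r,s,24) = 1`: `48 ∕ 24 ∕ 12 ∕ 0`, and `96` simple),
  **`fermatCMType_ne_of_primitive_twentyFour`** (no primitive triple has `H = {1,11,17,19}`), `three_dvd_of_fermatCMType_eq_twentyFour` (that `H`
  forces `3 ∣ r, s, t`: level `8`).
* §2 THE EXCEPTIONAL INVARIANTS' IDENTITY BLOCKS: **`fermatCMType_identityBlock_twentyFour`** (`(1,1,22), (5,5,14), (7,7,10), (11,11,2)`, all their
  permutations, and `(1,7,16)`: `H = {1,5,7,11}`), `fermatCMType_identityBlock_twelve` (`H_{1,1,10} = H_{5,5,2} = {1,5}` mod `12`),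
  `fermatCMType_identityBlock_eight` (`H_{1,1,6} = H_{3,3,2} = {1,3}` mod `8`).
* §3 ON ABELIAN VARIETIES (`L = ℚ(ζ₂₄)` any model; every realisation `A` of a K–R type `Φ_{H_τ}` mod `24`):
  **`exists_isIsogeny_pow_four_elliptic_fermat_twentyFour_sqrt_neg_six ∕ _sqrt_neg_one ∕ _sqrt_neg_three ∕ _sqrt_neg_two`** (`H_τ =` the group ⟹
  `A ∼ E⁴` `𝓞_{K₁}`-equivariantly, `E` ELLIPTIC with CM `𝓞_{K₁} → End E`, `K₁ = ℚ(δ)`, `δ² = −6 ∕ −1 ∕ −3 ∕ −2`; for `{1,5,7,11}` also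
  `ζ³+ζ⁹ ∉ K₁`), **`isSimple_fermat_twentyFour_of_mem`** (`H_τ` a translate ⟹ `A` a SIMPLE FOURFOLD), **`isIsogenous_fermat_twentyFour_of_mem`**
  («the corresponding `L_{r,s,t}` are all equal»: any two realisations of non-group K–R types at `24` are isogenous — `24 · 4` triples, ONE simple
  fourfold up to isogeny), **`isIsogenous_fermat_one_three_twenty_of_mem`** (each is isogenous to every realisation of `Φ_{H_{1,3,20}}`),
  **`fermat_twentyFour_dichotomy`** (EVERY admissible triple: simple fourfold `∼ A_{1,3,20}`-class, or `E⁴` with `E` CM by one of the four fields),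
  the identity blocks on varieties **`exists_isIsogeny_pow_four_elliptic_identityBlock_twentyFour`** (`(1,1,22), (5,5,14), (7,7,10), (11,11,2), (1,7,16)`:
  `E` has CM by `𝓞_{ℚ(√−6)}`, `√−2 ∉ K₁`), `exists_isIsogeny_sq_elliptic_identityBlock_eight` (`(3,3,2)` mod `8`: `ℚ(√−2)` as printed),
  `exists_isIsogeny_sq_elliptic_identityBlock_twelve` (`(5,5,2)` mod `12`: `ℚ(i)` as printed); non-vacuity `exists_realisation_fermat_twentyFour_classes`
  (fourfolds of types `H_{1,1,22}`, `H_{1,6,17}`, `H_{1,4,19}`, `H_{3,3,18}`, `H_{1,2,21}` exist).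

## Honest column

(a) `F_{24}`, its Jacobian and `J(F_{24}) ∼ ∏ L_{r,s,t}` are NOT constructed (tree FACT `HodgeTheory.Aoki2002_fermatFactor_cmTypeOf`, unused); all
«`F_{24} ∼ …`» content is typed on the K–R factor TYPES and as counts of triples.  (b) The `su(3)` modular invariants `E₈, E₁₂, E₂₄` are not
formalised; only the triangles BCIR prints for their identity blocks (and `(1,7,16)`) enter, as triples.  (c) The refinement `157 = 48+57+40+12`
by field and the primitive split are ours (kernel counts), not printed.  (d) Koblitz's list of the `n₀` with some elliptic `L_{r,s,t}` (BCIR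
[kob] = Koblitz 1978, Duke Math. J. 45) is not held and not typed.  The Hodge conjecture is not proved and nothing here bears on it.
-/

noncomputable section

open NumberField

namespace Literature.AlgebraicGeometry.ComplexMultiplication

open CategoryTheory CategoryTheory.Limits
open Literature.AlgebraicGeometry.Motives (CMType AbelianVariety)
open Literature.AlgebraicGeometry.Motives.AbelianVariety
open Literature.NumberTheory.ComplexMultiplication
open Literature.AlgebraicGeometry.HodgeTheory
open Literature.AlgebraicGeometry.Pohlmann1968 Literature.AlgebraicGeometry.Pohlmann1968.Cyclotomic
open CyclotomicCMTypeResidueSets (IsCMResidueSet unitResidues residueSet residueSet_cmTypeOfResidues isCMResidueSet_residueSet)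

/-! ## §0 «`24` is the largest integer to have this property»: every unit of `ℤ/N` squares to `1` iff `N ∣ 24` -/

section Carmichael

/-- **«Every element of `ℤ₂₄*` has a square equal to `1` modulo `24` (`24` is the largest integer to have this property)»**, in full: for
`N ≥ 1`, every unit of `ℤ/N` squares to `1` iff `N ∣ 24` (if `5 ∣ N`, a unit lifting `2 mod 5` has square `≢ 1`; if `5 ∤ N`, `5` is a unit and
`5² − 1 = 24 ≡ 0`; conversely every unit of `ℤ/N`, `N ∣ 24`, lifts to `(ℤ/24)ˣ`, where squares are `1`). [cite: BauerCosteItzyksonRuelle1997, §3.4] -/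
theorem forall_units_sq_eq_one_iff_dvd_twentyFour (N : ℕ) [NeZero N] : (∀ u : (ZMod N)ˣ, u ^ 2 = 1) ↔ N ∣ 24 := by
  constructor
  · intro h
    by_cases h5 : 5 ∣ N
    · exfalso
      obtain ⟨v, hv⟩ := ZMod.unitsMap_surjective h5 (ZMod.unitOfCoprime 2 (by decide : Nat.Coprime 2 5))
      have h2 : (ZMod.unitOfCoprime 2 (by decide : Nat.Coprime 2 5) : (ZMod 5)ˣ) ^ 2 = 1 := by
        rw [← hv, ← map_pow, h v, map_one]
      revert h2
      decide
    · have hc : Nat.Coprime 5 N := (Nat.Prime.coprime_iff_not_dvd (by norm_num)).2 h5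
      have h25 := h (ZMod.unitOfCoprime 5 hc)
      have h25' : ((5 : ℕ) : ZMod N) ^ 2 = 1 := by
        have := congrArg (fun u : (ZMod N)ˣ => (u : ZMod N)) h25
        simpa [ZMod.coe_unitOfCoprime] using this
      have h24 : ((24 : ℕ) : ZMod N) = 0 := by
        have e : ((24 : ℕ) : ZMod N) = ((5 : ℕ) : ZMod N) ^ 2 - 1 := by push_cast; ring
        rw [e, h25', sub_self]
      exact (ZMod.natCast_eq_zero_iff 24 N).1 h24
  · intro h u
    obtain ⟨v, rfl⟩ := ZMod.unitsMap_surjective (m := 24) h u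
    have hv : v ^ 2 = 1 := by revert v; decide
    rw [← map_pow, hv, map_one]

end Carmichael

namespace CyclotomicFermatCMType

/-! ## §1 The Koblitz–Rohrlich residue sets modulo `24`: four groups or four translates of `H_{1,3,20}`; counts by field -/

section Triples

/-- Examples, GROUP case: `H_{1,1,22} = H_{1,5,18} = {1,5,7,11}` (`ℚ(√−6)`), `H_{1,6,17} = H_{1,10,13} = {1,5,13,17}` (`ℚ(i)`),
`H_{1,4,19} = H_{4,7,13} = {1,7,13,19}` (`ℚ(√−3)`), `H_{3,3,18} = H_{3,9,12} = {1,11,17,19}` (`ℚ(√−2)`, non-primitive: `3·(1,1,6)`, `3·(1,3,4)`).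
[cite: BauerCosteItzyksonRuelle1997, §3.4] -/
theorem fermatCMType_twentyFour_group_examples :
    fermatCMType 24 1 1 22 = {1, 5, 7, 11} ∧ fermatCMType 24 1 5 18 = {1, 5, 7, 11} ∧
      fermatCMType 24 1 6 17 = {1, 5, 13, 17} ∧ fermatCMType 24 1 10 13 = {1, 5, 13, 17} ∧
      fermatCMType 24 1 4 19 = {1, 7, 13, 19} ∧ fermatCMType 24 4 7 13 = {1, 7, 13, 19} ∧
      fermatCMType 24 3 3 18 = {1, 11, 17, 19} ∧ fermatCMType 24 3 9 12 = {1, 11, 17, 19} := by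
  refine ⟨?_, ?_, ?_, ?_, ?_, ?_, ?_, ?_⟩ <;> decide

/-- Examples, SIMPLE case (the other three translates of `H_{1,3,20} = {1,5,11,17}` containing `1`): `H_{1,2,21} = {1,5,7,13}`,
`H_{1,9,14} = {1,7,11,19}`, `H_{2,3,19} = {1,13,17,19}`. [cite: BauerCosteItzyksonRuelle1997, §3.4] -/
theorem fermatCMType_twentyFour_simple_examples :
    fermatCMType 24 1 2 21 = {1, 5, 7, 13} ∧ fermatCMType 24 1 9 14 = {1, 7, 11, 19} ∧ fermatCMType 24 2 3 19 = {1, 13, 17, 19} := by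
  refine ⟨?_, ?_, ?_⟩ <;> decide

set_option maxRecDepth 100000 in
/-- **EVERY ADMISSIBLE TRIPLE MODULO `24`: `H_τ` IS ONE OF THE FOUR GROUPS OR ONE OF THE FOUR TRANSLATES OF `H_{1,3,20}` CONTAINING `1`.**  For all
`(r, s, t)` with `0 < r, s, t < 24`, `r + s + t = 24` (parametrised by `(r, s)`): `H_{r,s,t} ∈ {{1,5,7,11}, {1,5,13,17}, {1,7,13,19}, {1,11,17,19}}`
(«`H` is a group»: elliptic) or `H_{r,s,t} ∈ {{1,5,11,17}, {1,5,7,13}, {1,7,11,19}, {1,13,17,19}}` («not a group»: the simple class).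
[cite: BauerCosteItzyksonRuelle1997, §3.4] -/
theorem fermatCMType_twentyFour_mem_or_mem :
    ∀ p : ZMod 24 × ZMod 24, p.1 ≠ 0 → p.2 ≠ 0 → p.1.val + p.2.val < 24 →
      fermatCMType 24 p.1 p.2 (-(p.1 + p.2)) ∈
          ({{1, 5, 7, 11}, {1, 5, 13, 17}, {1, 7, 13, 19}, {1, 11, 17, 19}} : Finset (Finset (ZMod 24))) ∨
        fermatCMType 24 p.1 p.2 (-(p.1 + p.2)) ∈
          ({{1, 5, 11, 17}, {1, 5, 7, 13}, {1, 7, 11, 19}, {1, 13, 17, 19}} : Finset (Finset (ZMod 24))) := by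
  decide

set_option maxRecDepth 100000 in
/-- **BCIR'S `157` ELLIPTIC CURVES BY THEIR FIELD OF COMPLEX MULTIPLICATION** (counts of triples, ours): among the `253` admissible triples mod `24`,
exactly `48` have `H = {1,5,7,11}` (`ℚ(√−6)`), `57` have `H = {1,5,13,17}` (`ℚ(i)`), `40` have `H = {1,7,13,19}` (`ℚ(√−3)`), `12` have
`H = {1,11,17,19}` (`ℚ(√−2)`) — `48 + 57 + 40 + 12 = 157`. [cite: BauerCosteItzyksonRuelle1997, §3.4] -/
theorem card_triples_twentyFour_by_field :
    ((Finset.univ : Finset (ZMod 24 × ZMod 24)).filter fun p =>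
        p.1 ≠ 0 ∧ p.2 ≠ 0 ∧ p.1.val + p.2.val < 24 ∧ fermatCMType 24 p.1 p.2 (-(p.1 + p.2)) = {1, 5, 7, 11}).card = 48 ∧
    ((Finset.univ : Finset (ZMod 24 × ZMod 24)).filter fun p =>
        p.1 ≠ 0 ∧ p.2 ≠ 0 ∧ p.1.val + p.2.val < 24 ∧ fermatCMType 24 p.1 p.2 (-(p.1 + p.2)) = {1, 5, 13, 17}).card = 57 ∧
    ((Finset.univ : Finset (ZMod 24 × ZMod 24)).filter fun p =>
        p.1 ≠ 0 ∧ p.2 ≠ 0 ∧ p.1.val + p.2.val < 24 ∧ fermatCMType 24 p.1 p.2 (-(p.1 + p.2)) = {1, 7, 13, 19}).card = 40 ∧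
    ((Finset.univ : Finset (ZMod 24 × ZMod 24)).filter fun p =>
        p.1 ≠ 0 ∧ p.2 ≠ 0 ∧ p.1.val + p.2.val < 24 ∧ fermatCMType 24 p.1 p.2 (-(p.1 + p.2)) = {1, 11, 17, 19}).card = 12 := by
  refine ⟨?_, ?_, ?_, ?_⟩ <;> decide

set_option maxRecDepth 100000 in
/-- **The PRIMITIVE triples (`gcd(r, s, 24) = 1`, level exactly `24`) by class**: `48` with `H = {1,5,7,11}` (all of them), `24` with `{1,5,13,17}`,
`12` with `{1,7,13,19}`, NONE with `{1,11,17,19}`, and `96` in the simple class (all of it). [cite: BauerCosteItzyksonRuelle1997, §3.4]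
[cite: KoblitzRohrlich1978, §1 p. 1183] -/
theorem card_primitive_triples_twentyFour_by_field :
    ((Finset.univ : Finset (ZMod 24 × ZMod 24)).filter fun p =>
        p.1 ≠ 0 ∧ p.2 ≠ 0 ∧ p.1.val + p.2.val < 24 ∧ Nat.gcd (Nat.gcd p.1.val p.2.val) 24 = 1 ∧
          fermatCMType 24 p.1 p.2 (-(p.1 + p.2)) = {1, 5, 7, 11}).card = 48 ∧
    ((Finset.univ : Finset (ZMod 24 × ZMod 24)).filter fun p =>
        p.1 ≠ 0 ∧ p.2 ≠ 0 ∧ p.1.val + p.2.val < 24 ∧ Nat.gcd (Nat.gcd p.1.val p.2.val) 24 = 1 ∧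
          fermatCMType 24 p.1 p.2 (-(p.1 + p.2)) = {1, 5, 13, 17}).card = 24 ∧
    ((Finset.univ : Finset (ZMod 24 × ZMod 24)).filter fun p =>
        p.1 ≠ 0 ∧ p.2 ≠ 0 ∧ p.1.val + p.2.val < 24 ∧ Nat.gcd (Nat.gcd p.1.val p.2.val) 24 = 1 ∧
          fermatCMType 24 p.1 p.2 (-(p.1 + p.2)) = {1, 7, 13, 19}).card = 12 ∧
    ((Finset.univ : Finset (ZMod 24 × ZMod 24)).filter fun p =>
        p.1 ≠ 0 ∧ p.2 ≠ 0 ∧ p.1.val + p.2.val < 24 ∧ Nat.gcd (Nat.gcd p.1.val p.2.val) 24 = 1 ∧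
          fermatCMType 24 p.1 p.2 (-(p.1 + p.2)) = {1, 11, 17, 19}).card = 0 ∧
    ((Finset.univ : Finset (ZMod 24 × ZMod 24)).filter fun p =>
        p.1 ≠ 0 ∧ p.2 ≠ 0 ∧ p.1.val + p.2.val < 24 ∧ Nat.gcd (Nat.gcd p.1.val p.2.val) 24 = 1 ∧
          fermatCMType 24 p.1 p.2 (-(p.1 + p.2)) ∈
            ({{1, 5, 11, 17}, {1, 5, 7, 13}, {1, 7, 11, 19}, {1, 13, 17, 19}} : Finset (Finset (ZMod 24)))).card = 96 := by
  refine ⟨?_, ?_, ?_, ?_, ?_⟩ <;> decide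

set_option maxRecDepth 100000 in
/-- **NO PRIMITIVE TRIPLE AT LEVEL `24` HAS `H = {1,11,17,19}`** — the only stabiliser whose field is `ℚ(√−2)`: no simple factor «of level `24`»
has complex multiplication by `ℚ(√−2)`. [cite: BauerCosteItzyksonRuelle1997, §3.4] [cite: KoblitzRohrlich1978, §1 p. 1183] -/
theorem fermatCMType_ne_of_primitive_twentyFour :
    ∀ p : ZMod 24 × ZMod 24, p.1 ≠ 0 → p.2 ≠ 0 → p.1.val + p.2.val < 24 → Nat.gcd (Nat.gcd p.1.val p.2.val) 24 = 1 →
      fermatCMType 24 p.1 p.2 (-(p.1 + p.2)) ≠ {1, 11, 17, 19} := by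
  decide

set_option maxRecDepth 100000 in
/-- The twelve triples with `H = {1,11,17,19}` are multiples of `3` (level `8`; they are the `3·(r',s',t')` with `H_{r',s',t'} = {1,3}` mod `8`,
BCIR's `[ℤ(√−2)]^{12}` of `F_8 ⊂ F_{24}`). [cite: BauerCosteItzyksonRuelle1997, §3.4] -/
theorem three_dvd_of_fermatCMType_eq_twentyFour :
    ∀ p : ZMod 24 × ZMod 24, p.1 ≠ 0 → p.2 ≠ 0 → p.1.val + p.2.val < 24 →
      fermatCMType 24 p.1 p.2 (-(p.1 + p.2)) = {1, 11, 17, 19} → 3 ∣ p.1.val ∧ 3 ∣ p.2.val := by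
  decide

end Triples

/-! ## §2 The identity blocks of the exceptional invariants `E₂₄`, `E₁₂`, `E₈` as triples -/

section Blocks

/-- **THE IDENTITY BLOCK OF `E₂₄`: `H = {1,5,7,11}` THROUGHOUT.**  The four «triangles» `(1,1,22)`, `(5,5,14)`, `(7,7,10)`, `(11,11,2)` of the
identity block of the exceptional invariant at height `24`, all their permutations, and `(1,7,16)` («appearing in the second block of `E₂₄`») have
`H_{r,s,t} = {1,5,7,11}` — a GROUP (maximal splitting into elliptic curves, as printed), whose fixed field is `ℚ(√−6)` (prequel), the SAME for all
of them (as printed: «the same CM field»), and not `ℚ(√−2)` (kernel; cf. the module docstring).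
[cite: BauerCosteItzyksonRuelle1997, §4.3 (pp. 23–24) and §3.4 (p. 15)] -/
theorem fermatCMType_identityBlock_twentyFour :
    fermatCMType 24 1 1 22 = {1, 5, 7, 11} ∧ fermatCMType 24 1 22 1 = {1, 5, 7, 11} ∧ fermatCMType 24 22 1 1 = {1, 5, 7, 11} ∧
    fermatCMType 24 5 5 14 = {1, 5, 7, 11} ∧ fermatCMType 24 5 14 5 = {1, 5, 7, 11} ∧ fermatCMType 24 14 5 5 = {1, 5, 7, 11} ∧
    fermatCMType 24 7 7 10 = {1, 5, 7, 11} ∧ fermatCMType 24 7 10 7 = {1, 5, 7, 11} ∧ fermatCMType 24 10 7 7 = {1, 5, 7, 11} ∧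
    fermatCMType 24 11 11 2 = {1, 5, 7, 11} ∧ fermatCMType 24 11 2 11 = {1, 5, 7, 11} ∧ fermatCMType 24 2 11 11 = {1, 5, 7, 11} ∧
    fermatCMType 24 1 7 16 = {1, 5, 7, 11} ∧ fermatCMType 24 5 8 11 = {1, 5, 7, 11} := by
  refine ⟨?_, ?_, ?_, ?_, ?_, ?_, ?_, ?_, ?_, ?_, ?_, ?_, ?_, ?_⟩ <;> decide

/-- **The identity block of `E₁₂`**: `H_{1,1,10} = H_{5,5,2} = {1,5}` modulo `12` — the group of the field `ℚ(i) = ℚ(ζ₁₂³)` (sibling), as printed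
(«`ℚ(i)` for `n = 12`»). [cite: BauerCosteItzyksonRuelle1997, §4.3 (p. 23) and §3.4 (p. 15)] -/
theorem fermatCMType_identityBlock_twelve :
    fermatCMType 12 1 1 10 = {1, 5} ∧ fermatCMType 12 5 5 2 = {1, 5} ∧ fermatCMType 12 1 10 1 = {1, 5} ∧ fermatCMType 12 10 1 1 = {1, 5} ∧
      fermatCMType 12 5 2 5 = {1, 5} ∧ fermatCMType 12 2 5 5 = {1, 5} := by
  refine ⟨?_, ?_, ?_, ?_, ?_, ?_⟩ <;> decide

/-- **The identity block of `E₈`**: `H_{1,1,6} = H_{3,3,2} = {1,3}` modulo `8` — the group of the field `ℚ(√−2) = ℚ(ζ₈+ζ₈³)` (sibling), as printed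
(«`ℚ(√−2)` for `n = 8`»). [cite: BauerCosteItzyksonRuelle1997, §4.3 (p. 24) and §3.4 (p. 15)] -/
theorem fermatCMType_identityBlock_eight : fermatCMType 8 1 1 6 = {1, 3} ∧ fermatCMType 8 3 3 2 = {1, 3} := by
  refine ⟨?_, ?_⟩ <;> decide

end Blocks

/-! ## §3 On abelian varieties: the K–R types at `24` — `E⁴` by field, or the one simple class -/

section Varieties

/-- The four groups are their own stabilisers (kernel). [cite: BauerCosteItzyksonRuelle1997, §3.4] -/
private theorem stabilizerResidues_groups_twentyFour :
    ((unitResidues 24).filter fun t => ∀ c ∈ unitResidues 24,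
        (c * t ∈ ({1, 5, 7, 11} : Finset (ZMod 24)) ↔ c ∈ ({1, 5, 7, 11} : Finset (ZMod 24)))) = {1, 5, 7, 11} ∧
    ((unitResidues 24).filter fun t => ∀ c ∈ unitResidues 24,
        (c * t ∈ ({1, 5, 13, 17} : Finset (ZMod 24)) ↔ c ∈ ({1, 5, 13, 17} : Finset (ZMod 24)))) = {1, 5, 13, 17} ∧
    ((unitResidues 24).filter fun t => ∀ c ∈ unitResidues 24,
        (c * t ∈ ({1, 7, 13, 19} : Finset (ZMod 24)) ↔ c ∈ ({1, 7, 13, 19} : Finset (ZMod 24)))) = {1, 7, 13, 19} ∧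
    ((unitResidues 24).filter fun t => ∀ c ∈ unitResidues 24,
        (c * t ∈ ({1, 11, 17, 19} : Finset (ZMod 24)) ↔ c ∈ ({1, 11, 17, 19} : Finset (ZMod 24)))) = {1, 11, 17, 19} := by
  refine ⟨?_, ?_, ?_, ?_⟩ <;> decide

/-- The four translates of `H_{1,3,20}` containing `1` have trivial stabiliser (kernel). [cite: BauerCosteItzyksonRuelle1997, §3.4] -/
private theorem stabilizerResidues_translates_twentyFour :
    ((unitResidues 24).filter fun t => ∀ c ∈ unitResidues 24,
        (c * t ∈ ({1, 5, 11, 17} : Finset (ZMod 24)) ↔ c ∈ ({1, 5, 11, 17} : Finset (ZMod 24)))) = {1} ∧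
    ((unitResidues 24).filter fun t => ∀ c ∈ unitResidues 24,
        (c * t ∈ ({1, 5, 7, 13} : Finset (ZMod 24)) ↔ c ∈ ({1, 5, 7, 13} : Finset (ZMod 24)))) = {1} ∧
    ((unitResidues 24).filter fun t => ∀ c ∈ unitResidues 24,
        (c * t ∈ ({1, 7, 11, 19} : Finset (ZMod 24)) ↔ c ∈ ({1, 7, 11, 19} : Finset (ZMod 24)))) = {1} ∧
    ((unitResidues 24).filter fun t => ∀ c ∈ unitResidues 24,
        (c * t ∈ ({1, 13, 17, 19} : Finset (ZMod 24)) ↔ c ∈ ({1, 13, 17, 19} : Finset (ZMod 24)))) = {1} := by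
  refine ⟨?_, ?_, ?_, ?_⟩ <;> decide

/-- Hence a residue set in the class of `H_{1,3,20}` (containing `1`) has trivial stabiliser. [cite: BauerCosteItzyksonRuelle1997, §3.4] -/
private theorem stabilizerResidues_eq_singleton_of_mem_translates_twentyFour {S : Finset (ZMod 24)}
    (hS : S ∈ ({{1, 5, 11, 17}, {1, 5, 7, 13}, {1, 7, 11, 19}, {1, 13, 17, 19}} : Finset (Finset (ZMod 24)))) :
    ((unitResidues 24).filter fun t => ∀ c ∈ unitResidues 24, (c * t ∈ S ↔ c ∈ S)) = {1} := by
  simp only [Finset.mem_insert, Finset.mem_singleton] at hS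
  rcases hS with rfl | rfl | rfl | rfl
  · exact stabilizerResidues_translates_twentyFour.1
  · exact stabilizerResidues_translates_twentyFour.2.1
  · exact stabilizerResidues_translates_twentyFour.2.2.1
  · exact stabilizerResidues_translates_twentyFour.2.2.2

variable {L : Type} [Field L] [NumberField L] [IsCyclotomicExtension {24} ℚ L] {r s t r' s' t' : ZMod 24}
  {hS : ∀ c : ZMod 24, c.val.Coprime 24 → (c ∈ fermatCMType 24 r s t ↔ -c ∉ fermatCMType 24 r s t)}
  {hS' : ∀ c : ZMod 24, c.val.Coprime 24 → (c ∈ fermatCMType 24 r' s' t' ↔ -c ∉ fermatCMType 24 r' s' t')}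
  {A A' : AbelianVariety ℂ} {ι : 𝓞 L →+* End A} {θ : L →+* Module.End ℂ (complexBetti A.X 1)}
  {ι' : 𝓞 L →+* End A'} {θ' : L →+* Module.End ℂ (complexBetti A'.X 1)}

/-- **`H_τ = {1,5,7,11}` ⟹ `A_τ ∼ E⁴`, `E` ELLIPTIC WITH CM BY `𝓞_{ℚ(√−6)}`** (`K₁ = ℚ(ζ+ζ⁵+ζ⁷+ζ¹¹)`, `(·)² = −6`, `ζ³+ζ⁹ ∉ K₁`): every realisation of
`Φ_{H_τ}` for such a Koblitz–Rohrlich triple at `24` (e.g. `(1,1,22)`, `(1,7,16)`; `48` triples). [cite: BauerCosteItzyksonRuelle1997, §3.3–3.4]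
[cite: KoblitzRohrlich1978, §1 p. 1184] [cite: Shimura1998, §8.2 Prop. 26, §6.2 Thm. 3] -/
theorem exists_isIsogeny_pow_four_elliptic_fermat_twentyFour_sqrt_neg_six (hH : fermatCMType 24 r s t = {1, 5, 7, 11})
    (hA : IsCMTypeRealisation (cmTypeOfResidues (L := L) (fermatCMType 24 r s t) hS) A ι θ) :
    ∃ (K₁ : IntermediateField ℚ L) (Φ₁ : CMType K₁), IsCMField K₁ ∧
      zetaOf 24 L + zetaOf 24 L ^ 5 + zetaOf 24 L ^ 7 + zetaOf 24 L ^ 11 ∈ K₁ ∧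
      K₁ = IntermediateField.adjoin ℚ {zetaOf 24 L + zetaOf 24 L ^ 5 + zetaOf 24 L ^ 7 + zetaOf 24 L ^ 11} ∧
      (zetaOf 24 L + zetaOf 24 L ^ 5 + zetaOf 24 L ^ 7 + zetaOf 24 L ^ 11) ^ 2 = -6 ∧ zetaOf 24 L ^ 3 + zetaOf 24 L ^ 9 ∉ K₁ ∧
      Module.finrank ℚ K₁ = 2 ∧ A.dim = 4 ∧
      inducedCMType (algebraMap K₁ L) Φ₁ = cmTypeOfResidues (L := L) (fermatCMType 24 r s t) hS ∧
      ∃ (E : AbelianVariety ℂ) (ιE : 𝓞 K₁ →+* End E) (θE : K₁ →+* Module.End ℂ (complexBetti E.X 1)),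
        IsCMTypeRealisation Φ₁ E ιE θE ∧ E.dim = 1 ∧
        ∃ (P : AbelianVariety ℂ) (π : Fin 4 → (P ⟶ E)), Nonempty (IsLimit (Fan.mk P π)) ∧
          ∃ g : A ⟶ P, IsIsogeny g ∧
            ∀ j (b : 𝓞 K₁), ι (RingOfIntegers.mapRingHom (algebraMap K₁ L : K₁ →+* L) b) ≫ (g ≫ π j) =
              (g ≫ π j) ≫ ιE b := by
  have hcm : IsCMResidueSet 24 (fermatCMType 24 r s t) := isCMResidueSet_fermatCMType hS
  have hW : ((unitResidues 24).filter fun x => ∀ c ∈ unitResidues 24,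
      (c * x ∈ residueSet 24 (cmTypeOfResidues (L := L) (fermatCMType 24 r s t) hS) ↔
        c ∈ residueSet 24 (cmTypeOfResidues (L := L) (fermatCMType 24 r s t) hS))) = {1, 5, 7, 11} := by
    rw [residueSet_cmTypeOfResidues 24 hcm, hH]
    exact stabilizerResidues_groups_twentyFour.1
  obtain ⟨K₁, Φ₁, hCM, h₁, hp₁, hdeg, hdA, E, ιE, θE, hE, hdE, P, π, hP, g, hg, hequiv⟩ :=
    exists_isIsogeny_pow_four_elliptic_of_card_eq_four_twentyFour hA (by rw [hW]; decide)
  obtain ⟨hmem, hK, hsq, -⟩ := eq_adjoin_gaussPeriod_of_stabilizerResidues_eq _ Φ₁ h₁ hp₁ hW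
  have hnot := zetaOf_pow_three_add_pow_nine_notMem_of_stabilizerResidues_eq _ Φ₁ h₁ hp₁ hW
  exact ⟨K₁, Φ₁, hCM, hmem, hK, hsq, hnot, hdeg, hdA, h₁, E, ιE, θE, hE, hdE, P, π, hP, g, hg, hequiv⟩

/-- **`H_τ = {1,5,13,17}` ⟹ `A_τ ∼ E⁴`, `E` ELLIPTIC WITH CM BY `𝓞_{ℚ(i)}`** (`K₁ = ℚ(ζ⁶)`, `(ζ⁶)² = −1`; e.g. `(1,6,17)`; `57` triples).
[cite: BauerCosteItzyksonRuelle1997, §3.3–3.4] [cite: KoblitzRohrlich1978, §1 p. 1184] [cite: Shimura1998, §8.2 Prop. 26, §6.2 Thm. 3] -/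
theorem exists_isIsogeny_pow_four_elliptic_fermat_twentyFour_sqrt_neg_one (hH : fermatCMType 24 r s t = {1, 5, 13, 17})
    (hA : IsCMTypeRealisation (cmTypeOfResidues (L := L) (fermatCMType 24 r s t) hS) A ι θ) :
    ∃ (K₁ : IntermediateField ℚ L) (Φ₁ : CMType K₁), IsCMField K₁ ∧
      zetaOf 24 L ^ 6 ∈ K₁ ∧ K₁ = IntermediateField.adjoin ℚ {zetaOf 24 L ^ 6} ∧ (zetaOf 24 L ^ 6) ^ 2 = -1 ∧
      Module.finrank ℚ K₁ = 2 ∧ A.dim = 4 ∧ inducedCMType (algebraMap K₁ L) Φ₁ = cmTypeOfResidues (L := L) (fermatCMType 24 r s t) hS ∧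
      ∃ (E : AbelianVariety ℂ) (ιE : 𝓞 K₁ →+* End E) (θE : K₁ →+* Module.End ℂ (complexBetti E.X 1)),
        IsCMTypeRealisation Φ₁ E ιE θE ∧ E.dim = 1 ∧
        ∃ (P : AbelianVariety ℂ) (π : Fin 4 → (P ⟶ E)), Nonempty (IsLimit (Fan.mk P π)) ∧
          ∃ g : A ⟶ P, IsIsogeny g ∧
            ∀ j (b : 𝓞 K₁), ι (RingOfIntegers.mapRingHom (algebraMap K₁ L : K₁ →+* L) b) ≫ (g ≫ π j) =
              (g ≫ π j) ≫ ιE b := by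
  have hcm : IsCMResidueSet 24 (fermatCMType 24 r s t) := isCMResidueSet_fermatCMType hS
  refine exists_isIsogeny_pow_four_elliptic_sqrt_neg_one hA ?_
  rw [residueSet_cmTypeOfResidues 24 hcm, hH]
  exact stabilizerResidues_groups_twentyFour.2.1

/-- **`H_τ = {1,7,13,19}` ⟹ `A_τ ∼ E⁴`, `E` ELLIPTIC WITH CM BY `𝓞_{ℚ(√−3)}`** (`K₁ = ℚ(1+2ζ⁸) ∋ ζ⁸ = ω`, `(1+2ζ⁸)² = −3`; e.g. `(1,4,19)`; `40`
triples). [cite: BauerCosteItzyksonRuelle1997, §3.3–3.4] [cite: KoblitzRohrlich1978, §1 p. 1184] [cite: Shimura1998, §8.2 Prop. 26, §6.2 Thm. 3] -/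
theorem exists_isIsogeny_pow_four_elliptic_fermat_twentyFour_sqrt_neg_three (hH : fermatCMType 24 r s t = {1, 7, 13, 19})
    (hA : IsCMTypeRealisation (cmTypeOfResidues (L := L) (fermatCMType 24 r s t) hS) A ι θ) :
    ∃ (K₁ : IntermediateField ℚ L) (Φ₁ : CMType K₁), IsCMField K₁ ∧
      1 + 2 * zetaOf 24 L ^ 8 ∈ K₁ ∧ zetaOf 24 L ^ 8 ∈ K₁ ∧ K₁ = IntermediateField.adjoin ℚ {1 + 2 * zetaOf 24 L ^ 8} ∧
      (1 + 2 * zetaOf 24 L ^ 8) ^ 2 = -3 ∧ Module.finrank ℚ K₁ = 2 ∧ A.dim = 4 ∧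
      inducedCMType (algebraMap K₁ L) Φ₁ = cmTypeOfResidues (L := L) (fermatCMType 24 r s t) hS ∧
      ∃ (E : AbelianVariety ℂ) (ιE : 𝓞 K₁ →+* End E) (θE : K₁ →+* Module.End ℂ (complexBetti E.X 1)),
        IsCMTypeRealisation Φ₁ E ιE θE ∧ E.dim = 1 ∧
        ∃ (P : AbelianVariety ℂ) (π : Fin 4 → (P ⟶ E)), Nonempty (IsLimit (Fan.mk P π)) ∧
          ∃ g : A ⟶ P, IsIsogeny g ∧
            ∀ j (b : 𝓞 K₁), ι (RingOfIntegers.mapRingHom (algebraMap K₁ L : K₁ →+* L) b) ≫ (g ≫ π j) =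
              (g ≫ π j) ≫ ιE b := by
  have hcm : IsCMResidueSet 24 (fermatCMType 24 r s t) := isCMResidueSet_fermatCMType hS
  refine exists_isIsogeny_pow_four_elliptic_sqrt_neg_three hA ?_
  rw [residueSet_cmTypeOfResidues 24 hcm, hH]
  exact stabilizerResidues_groups_twentyFour.2.2.1

/-- **`H_τ = {1,11,17,19}` ⟹ `A_τ ∼ E⁴`, `E` ELLIPTIC WITH CM BY `𝓞_{ℚ(√−2)}`** (`K₁ = ℚ(ζ³+ζ⁹)`, `(ζ³+ζ⁹)² = −2`; only the twelve non-primitive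
triples `3·(r',s',t')`, e.g. `(3,3,18)`). [cite: BauerCosteItzyksonRuelle1997, §3.3–3.4] [cite: KoblitzRohrlich1978, §1 p. 1184]
[cite: Shimura1998, §8.2 Prop. 26, §6.2 Thm. 3] -/
theorem exists_isIsogeny_pow_four_elliptic_fermat_twentyFour_sqrt_neg_two (hH : fermatCMType 24 r s t = {1, 11, 17, 19})
    (hA : IsCMTypeRealisation (cmTypeOfResidues (L := L) (fermatCMType 24 r s t) hS) A ι θ) :
    ∃ (K₁ : IntermediateField ℚ L) (Φ₁ : CMType K₁), IsCMField K₁ ∧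
      zetaOf 24 L ^ 3 + zetaOf 24 L ^ 9 ∈ K₁ ∧ K₁ = IntermediateField.adjoin ℚ {zetaOf 24 L ^ 3 + zetaOf 24 L ^ 9} ∧
      (zetaOf 24 L ^ 3 + zetaOf 24 L ^ 9) ^ 2 = -2 ∧ Module.finrank ℚ K₁ = 2 ∧ A.dim = 4 ∧
      inducedCMType (algebraMap K₁ L) Φ₁ = cmTypeOfResidues (L := L) (fermatCMType 24 r s t) hS ∧
      ∃ (E : AbelianVariety ℂ) (ιE : 𝓞 K₁ →+* End E) (θE : K₁ →+* Module.End ℂ (complexBetti E.X 1)),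
        IsCMTypeRealisation Φ₁ E ιE θE ∧ E.dim = 1 ∧
        ∃ (P : AbelianVariety ℂ) (π : Fin 4 → (P ⟶ E)), Nonempty (IsLimit (Fan.mk P π)) ∧
          ∃ g : A ⟶ P, IsIsogeny g ∧
            ∀ j (b : 𝓞 K₁), ι (RingOfIntegers.mapRingHom (algebraMap K₁ L : K₁ →+* L) b) ≫ (g ≫ π j) =
              (g ≫ π j) ≫ ιE b := by
  have hcm : IsCMResidueSet 24 (fermatCMType 24 r s t) := isCMResidueSet_fermatCMType hS
  refine exists_isIsogeny_pow_four_elliptic_sqrt_neg_two hA ?_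
  rw [residueSet_cmTypeOfResidues 24 hcm, hH]
  exact stabilizerResidues_groups_twentyFour.2.2.2

/-- **«`L_{1,3,20} ⊂ ℂ⁴` simple because `W_{1,3,20} = {1}`», for the whole class**: if `H_τ` is one of the four translates of `H_{1,3,20}` containing
`1` (the `24 · 4` non-group triples), every realisation of `Φ_{H_τ}` is a SIMPLE abelian FOURFOLD. [cite: BauerCosteItzyksonRuelle1997, §3.4]
[cite: Shimura1998, §8.2 Prop. 26] -/
theorem isSimple_fermat_twentyFour_of_mem
    (hH : fermatCMType 24 r s t ∈ ({{1, 5, 11, 17}, {1, 5, 7, 13}, {1, 7, 11, 19}, {1, 13, 17, 19}} : Finset (Finset (ZMod 24))))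
    (hA : IsCMTypeRealisation (cmTypeOfResidues (L := L) (fermatCMType 24 r s t) hS) A ι θ) : A.IsSimple ∧ A.dim = 4 := by
  have hcm : IsCMResidueSet 24 (fermatCMType 24 r s t) := isCMResidueSet_fermatCMType hS
  refine ⟨?_, dim_eq_four_twentyFour hA⟩
  rw [isSimple_iff_stabilizerResidues_eq_singleton (N := 24) hA, residueSet_cmTypeOfResidues 24 hcm]
  exact stabilizerResidues_eq_singleton_of_mem_translates_twentyFour hH

/-- **«THE CORRESPONDING `L_{r,s,t}` ARE ALL EQUAL»**: any two Koblitz–Rohrlich types at `24` whose residue sets are NOT groups (i.e. lie in the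
class of `H_{1,3,20}`) have ISOGENOUS realisations — the `24 · 4` non-group triples contribute ONE simple fourfold up to isogeny
(«`[ℂ⁴/L_{1,3,20}]^{24}`»). [cite: BauerCosteItzyksonRuelle1997, §3.4] [cite: Shimura1998, §8.4 Example (1)] -/
theorem isIsogenous_fermat_twentyFour_of_mem
    (hH : fermatCMType 24 r s t ∈ ({{1, 5, 11, 17}, {1, 5, 7, 13}, {1, 7, 11, 19}, {1, 13, 17, 19}} : Finset (Finset (ZMod 24))))
    (hH' : fermatCMType 24 r' s' t' ∈ ({{1, 5, 11, 17}, {1, 5, 7, 13}, {1, 7, 11, 19}, {1, 13, 17, 19}} : Finset (Finset (ZMod 24))))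
    (hA : IsCMTypeRealisation (cmTypeOfResidues (L := L) (fermatCMType 24 r s t) hS) A ι θ)
    (hA' : IsCMTypeRealisation (cmTypeOfResidues (L := L) (fermatCMType 24 r' s' t') hS') A' ι' θ') : IsIsogenous A A' :=
  isIsogenous_of_isSimple_twentyFour hA hA' (isSimple_fermat_twentyFour_of_mem hH hA).1 (isSimple_fermat_twentyFour_of_mem hH' hA').1

/-- In particular every realisation of a non-group K–R type at `24` is isogenous to every realisation of `Φ_{H_{1,3,20}}` (the sibling's simple
fourfolds). [cite: BauerCosteItzyksonRuelle1997, §3.4] -/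
theorem isIsogenous_fermat_one_three_twenty_of_mem
    (hH : fermatCMType 24 r s t ∈ ({{1, 5, 11, 17}, {1, 5, 7, 13}, {1, 7, 11, 19}, {1, 13, 17, 19}} : Finset (Finset (ZMod 24))))
    {hS₀ : ∀ c : ZMod 24, c.val.Coprime 24 → (c ∈ fermatCMType 24 1 3 20 ↔ -c ∉ fermatCMType 24 1 3 20)}
    {A₀ : AbelianVariety ℂ} {ι₀ : 𝓞 L →+* End A₀} {θ₀ : L →+* Module.End ℂ (complexBetti A₀.X 1)}
    (hA : IsCMTypeRealisation (cmTypeOfResidues (L := L) (fermatCMType 24 r s t) hS) A ι θ)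
    (hA₀ : IsCMTypeRealisation (cmTypeOfResidues (L := L) (fermatCMType 24 1 3 20) hS₀) A₀ ι₀ θ₀) : IsIsogenous A A₀ :=
  isIsogenous_fermat_twentyFour_of_mem hH (by rw [fermatCMType_twentyFour_one_three_twenty]; decide) hA hA₀

/-- **THE KOBLITZ–ROHRLICH FACTOR TYPES AT `24`, ALL OF THEM** («`F_{24} ∼ [ℂ⁴/L_{1,3,20}]^{24} ⊕ [product of 157 elliptic curves]`» read type by
type): for every admissible `(r, s, t)` mod `24` (`r, s ≠ 0`, `⟨r⟩ + ⟨s⟩ < 24`, `t = −r−s`) and every realisation `A` of `Φ_{H_{r,s,t}}`: EITHER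
`H_{r,s,t}` is in the class of `H_{1,3,20}` and `A` is a SIMPLE FOURFOLD (isogenous to all the others of that class), OR `H_{r,s,t}` is one of the
four groups and `A ∼ E⁴` with `E` an elliptic curve with complex multiplication by `𝓞_{ℚ(δ)}`, `δ² ∈ {−6, −1, −3, −2}`.
[cite: BauerCosteItzyksonRuelle1997, §3.4] [cite: KoblitzRohrlich1978, §1 p. 1184] [cite: Shimura1998, §8.2 Prop. 26, §6.2 Thm. 3] -/
theorem fermat_twentyFour_dichotomy (hr : r ≠ 0) (hs : s ≠ 0) (hrs : r.val + s.val < 24) (ht : t = -(r + s))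
    (hA : IsCMTypeRealisation (cmTypeOfResidues (L := L) (fermatCMType 24 r s t) hS) A ι θ) :
    (fermatCMType 24 r s t ∈ ({{1, 5, 11, 17}, {1, 5, 7, 13}, {1, 7, 11, 19}, {1, 13, 17, 19}} : Finset (Finset (ZMod 24))) ∧
        A.IsSimple ∧ A.dim = 4) ∨
      (fermatCMType 24 r s t ∈ ({{1, 5, 7, 11}, {1, 5, 13, 17}, {1, 7, 13, 19}, {1, 11, 17, 19}} : Finset (Finset (ZMod 24))) ∧
        ∃ (K₁ : IntermediateField ℚ L) (Φ₁ : CMType K₁) (δ : L), IsCMField K₁ ∧ δ ∈ K₁ ∧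
          K₁ = IntermediateField.adjoin ℚ {δ} ∧ (δ ^ 2 = -6 ∨ δ ^ 2 = -1 ∨ δ ^ 2 = -3 ∨ δ ^ 2 = -2) ∧ Module.finrank ℚ K₁ = 2 ∧ A.dim = 4 ∧
          inducedCMType (algebraMap K₁ L) Φ₁ = cmTypeOfResidues (L := L) (fermatCMType 24 r s t) hS ∧
          ∃ (E : AbelianVariety ℂ) (ιE : 𝓞 K₁ →+* End E) (θE : K₁ →+* Module.End ℂ (complexBetti E.X 1)),
            IsCMTypeRealisation Φ₁ E ιE θE ∧ E.dim = 1 ∧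
            ∃ (P : AbelianVariety ℂ) (π : Fin 4 → (P ⟶ E)), Nonempty (IsLimit (Fan.mk P π)) ∧ ∃ g : A ⟶ P, IsIsogeny g) := by
  subst ht
  rcases fermatCMType_twentyFour_mem_or_mem (r, s) hr hs hrs with hG | hT
  · right
    refine ⟨hG, ?_⟩
    have hG' := hG
    simp only [Finset.mem_insert, Finset.mem_singleton] at hG'
    rcases hG' with h | h | h | h
    · obtain ⟨K₁, Φ₁, hCM, hmem, hK, hsq, -, hdeg, hdA, h₁, E, ιE, θE, hE, hdE, P, π, hP, g, hg, -⟩ :=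
        exists_isIsogeny_pow_four_elliptic_fermat_twentyFour_sqrt_neg_six h hA
      exact ⟨K₁, Φ₁, _, hCM, hmem, hK, Or.inl hsq, hdeg, hdA, h₁, E, ιE, θE, hE, hdE, P, π, hP, g, hg⟩
    · obtain ⟨K₁, Φ₁, hCM, hmem, hK, hsq, hdeg, hdA, h₁, E, ιE, θE, hE, hdE, P, π, hP, g, hg, -⟩ :=
        exists_isIsogeny_pow_four_elliptic_fermat_twentyFour_sqrt_neg_one h hA
      exact ⟨K₁, Φ₁, _, hCM, hmem, hK, Or.inr (Or.inl hsq), hdeg, hdA, h₁, E, ιE, θE, hE, hdE, P, π, hP, g, hg⟩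
    · obtain ⟨K₁, Φ₁, hCM, hmem, -, hK, hsq, hdeg, hdA, h₁, E, ιE, θE, hE, hdE, P, π, hP, g, hg, -⟩ :=
        exists_isIsogeny_pow_four_elliptic_fermat_twentyFour_sqrt_neg_three h hA
      exact ⟨K₁, Φ₁, _, hCM, hmem, hK, Or.inr (Or.inr (Or.inl hsq)), hdeg, hdA, h₁, E, ιE, θE, hE, hdE, P, π, hP, g, hg⟩
    · obtain ⟨K₁, Φ₁, hCM, hmem, hK, hsq, hdeg, hdA, h₁, E, ιE, θE, hE, hdE, P, π, hP, g, hg, -⟩ :=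
        exists_isIsogeny_pow_four_elliptic_fermat_twentyFour_sqrt_neg_two h hA
      exact ⟨K₁, Φ₁, _, hCM, hmem, hK, Or.inr (Or.inr (Or.inr hsq)), hdeg, hdA, h₁, E, ιE, θE, hE, hdE, P, π, hP, g, hg⟩
  · exact Or.inl ⟨hT, isSimple_fermat_twentyFour_of_mem hT hA⟩

/-! ### The identity blocks on abelian varieties -/

/-- **THE IDENTITY BLOCK OF `E₂₄` ON ABELIAN VARIETIES: CM BY `ℚ(√−6)`.**  For each of the printed triangles `(1,1,22)`, `(5,5,14)`, `(7,7,10)`,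
`(11,11,2)` and for `(1,7,16)`, every realisation of `Φ_{H_τ}` is a fourfold `∼ E⁴` with `E` an elliptic curve with complex multiplication by
`𝓞_{K₁}`, `K₁ = ℚ(ζ+ζ⁵+ζ⁷+ζ¹¹)`, `(ζ+ζ⁵+ζ⁷+ζ¹¹)² = −6`, and `ζ³+ζ⁹ = √−2 ∉ K₁` («the same CM field» — here `ℚ(√−6)`; the printed «`ℚ(√−2)` for
`n = 24`» is not what the kernel finds). [cite: BauerCosteItzyksonRuelle1997, §4.3 (pp. 23–24) and §3.4 (p. 15)] [cite: KoblitzRohrlich1978, §1 p. 1184] -/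
theorem exists_isIsogeny_pow_four_elliptic_identityBlock_twentyFour
    (hτ : (r, s, t) = (1, 1, 22) ∨ (r, s, t) = (5, 5, 14) ∨ (r, s, t) = (7, 7, 10) ∨ (r, s, t) = (11, 11, 2) ∨ (r, s, t) = (1, 7, 16))
    (hA : IsCMTypeRealisation (cmTypeOfResidues (L := L) (fermatCMType 24 r s t) hS) A ι θ) :
    ∃ (K₁ : IntermediateField ℚ L) (Φ₁ : CMType K₁), IsCMField K₁ ∧
      zetaOf 24 L + zetaOf 24 L ^ 5 + zetaOf 24 L ^ 7 + zetaOf 24 L ^ 11 ∈ K₁ ∧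
      K₁ = IntermediateField.adjoin ℚ {zetaOf 24 L + zetaOf 24 L ^ 5 + zetaOf 24 L ^ 7 + zetaOf 24 L ^ 11} ∧
      (zetaOf 24 L + zetaOf 24 L ^ 5 + zetaOf 24 L ^ 7 + zetaOf 24 L ^ 11) ^ 2 = -6 ∧ zetaOf 24 L ^ 3 + zetaOf 24 L ^ 9 ∉ K₁ ∧
      Module.finrank ℚ K₁ = 2 ∧ A.dim = 4 ∧
      inducedCMType (algebraMap K₁ L) Φ₁ = cmTypeOfResidues (L := L) (fermatCMType 24 r s t) hS ∧
      ∃ (E : AbelianVariety ℂ) (ιE : 𝓞 K₁ →+* End E) (θE : K₁ →+* Module.End ℂ (complexBetti E.X 1)),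
        IsCMTypeRealisation Φ₁ E ιE θE ∧ E.dim = 1 ∧
        ∃ (P : AbelianVariety ℂ) (π : Fin 4 → (P ⟶ E)), Nonempty (IsLimit (Fan.mk P π)) ∧
          ∃ g : A ⟶ P, IsIsogeny g ∧
            ∀ j (b : 𝓞 K₁), ι (RingOfIntegers.mapRingHom (algebraMap K₁ L : K₁ →+* L) b) ≫ (g ≫ π j) =
              (g ≫ π j) ≫ ιE b := by
  refine exists_isIsogeny_pow_four_elliptic_fermat_twentyFour_sqrt_neg_six ?_ hA
  have hb := fermatCMType_identityBlock_twentyFour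
  rcases hτ with h | h | h | h | h <;> simp only [Prod.mk.injEq] at h <;> obtain ⟨rfl, rfl, rfl⟩ := h
  · exact hb.1
  · exact hb.2.2.2.1
  · exact hb.2.2.2.2.2.2.1
  · exact hb.2.2.2.2.2.2.2.2.2.1
  · exact hb.2.2.2.2.2.2.2.2.2.2.2.2.1

/-- **The identity block of `E₈` on abelian surfaces: `ℚ(√−2)` as printed** — `(3,3,2)` mod `8` (the sibling did `(1,1,6)`): `H = {1,3}`, every
realisation `∼ E × E` with `E` CM by `𝓞_{ℚ(ζ₈+ζ₈³)}`, `(ζ₈+ζ₈³)² = −2`. [cite: BauerCosteItzyksonRuelle1997, §4.3 (p. 24) and §3.4 (p. 15)] -/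
theorem exists_isIsogeny_sq_elliptic_identityBlock_eight {L : Type} [Field L] [NumberField L] [IsCyclotomicExtension {8} ℚ L]
    {hS : ∀ c : ZMod 8, c.val.Coprime 8 → (c ∈ fermatCMType 8 3 3 2 ↔ -c ∉ fermatCMType 8 3 3 2)} {A : AbelianVariety ℂ}
    {ι : 𝓞 L →+* End A} {θ : L →+* Module.End ℂ (complexBetti A.X 1)}
    (hA : IsCMTypeRealisation (cmTypeOfResidues (L := L) (fermatCMType 8 3 3 2) hS) A ι θ) :
    ∃ (K₁ : IntermediateField ℚ L) (Φ₁ : CMType K₁), IsCMField K₁ ∧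
      zetaOf 8 L + zetaOf 8 L ^ 3 ∈ K₁ ∧ K₁ = IntermediateField.adjoin ℚ {zetaOf 8 L + zetaOf 8 L ^ 3} ∧
      (zetaOf 8 L + zetaOf 8 L ^ 3) ^ 2 = -2 ∧ Module.finrank ℚ K₁ = 2 ∧ A.dim = 2 ∧
      inducedCMType (algebraMap K₁ L) Φ₁ = cmTypeOfResidues (L := L) (fermatCMType 8 3 3 2) hS ∧
      ∃ (E : AbelianVariety ℂ) (ιE : 𝓞 K₁ →+* End E) (θE : K₁ →+* Module.End ℂ (complexBetti E.X 1)),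
        IsCMTypeRealisation Φ₁ E ιE θE ∧ E.dim = 1 ∧
        ∃ (P : AbelianVariety ℂ) (π : Fin 2 → (P ⟶ E)), Nonempty (IsLimit (Fan.mk P π)) ∧
          ∃ g : A ⟶ P, IsIsogeny g ∧
            ∀ j (b : 𝓞 K₁), ι (RingOfIntegers.mapRingHom (algebraMap K₁ L : K₁ →+* L) b) ≫ (g ≫ π j) =
              (g ≫ π j) ≫ ιE b :=
  exists_isIsogeny_sq_elliptic_fermat_eight_of_eq_pair fermatCMType_identityBlock_eight.2 hA

/-- **The identity block of `E₁₂` on abelian surfaces: `ℚ(i)` as printed** — `(5,5,2)` mod `12` (the sibling did `(1,1,10)`): `H = {1,5}`, every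
realisation `∼ E × E` with `E` CM by `𝓞_{ℚ(ζ₁₂³)}`, `(ζ₁₂³)² = −1`. [cite: BauerCosteItzyksonRuelle1997, §4.3 (p. 23) and §3.4 (p. 15)] -/
theorem exists_isIsogeny_sq_elliptic_identityBlock_twelve {L : Type} [Field L] [NumberField L] [IsCyclotomicExtension {12} ℚ L]
    {hS : ∀ c : ZMod 12, c.val.Coprime 12 → (c ∈ fermatCMType 12 5 5 2 ↔ -c ∉ fermatCMType 12 5 5 2)} {A : AbelianVariety ℂ}
    {ι : 𝓞 L →+* End A} {θ : L →+* Module.End ℂ (complexBetti A.X 1)}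
    (hA : IsCMTypeRealisation (cmTypeOfResidues (L := L) (fermatCMType 12 5 5 2) hS) A ι θ) :
    ∃ (K₁ : IntermediateField ℚ L) (Φ₁ : CMType K₁), IsCMField K₁ ∧
      zetaOf 12 L ^ 3 ∈ K₁ ∧ K₁ = IntermediateField.adjoin ℚ {zetaOf 12 L ^ 3} ∧
      (zetaOf 12 L ^ 3) ^ 2 = -1 ∧ Module.finrank ℚ K₁ = 2 ∧ A.dim = 2 ∧
      inducedCMType (algebraMap K₁ L) Φ₁ = cmTypeOfResidues (L := L) (fermatCMType 12 5 5 2) hS ∧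
      ∃ (E : AbelianVariety ℂ) (ιE : 𝓞 K₁ →+* End E) (θE : K₁ →+* Module.End ℂ (complexBetti E.X 1)),
        IsCMTypeRealisation Φ₁ E ιE θE ∧ E.dim = 1 ∧
        ∃ (P : AbelianVariety ℂ) (π : Fin 2 → (P ⟶ E)), Nonempty (IsLimit (Fan.mk P π)) ∧
          ∃ g : A ⟶ P, IsIsogeny g ∧
            ∀ j (b : 𝓞 K₁), ι (RingOfIntegers.mapRingHom (algebraMap K₁ L : K₁ →+* L) b) ≫ (g ≫ π j) =
              (g ≫ π j) ≫ ιE b :=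
  exists_isIsogeny_sq_elliptic_fermat_twelve_of_eq_pair fermatCMType_identityBlock_twelve.2.1 hA

/-! ### Non-vacuity: the five classes are realised by Koblitz–Rohrlich types at `24` -/

/-- Non-vacuity: the K–R types of `(1,1,22)` (`ℚ(√−6)`), `(1,6,17)` (`ℚ(i)`), `(1,4,19)` (`ℚ(√−3)`), `(3,3,18)` (`ℚ(√−2)`) and `(1,2,21)` (simple)
are realised by abelian fourfolds (`(1,3,20)` is the sibling's). [cite: Shimura1998, §6.2 Thm. 3] [cite: BauerCosteItzyksonRuelle1997, §3.4] -/
theorem exists_realisation_fermat_twentyFour_classes :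
    (∃ (hS : ∀ c : ZMod 24, c.val.Coprime 24 → (c ∈ fermatCMType 24 1 1 22 ↔ -c ∉ fermatCMType 24 1 1 22))
      (A : AbelianVariety ℂ) (ι : 𝓞 L →+* End A) (θ : L →+* Module.End ℂ (complexBetti A.X 1)),
      IsCMTypeRealisation (cmTypeOfResidues (L := L) (fermatCMType 24 1 1 22) hS) A ι θ ∧ A.dim = 4) ∧
    (∃ (hS : ∀ c : ZMod 24, c.val.Coprime 24 → (c ∈ fermatCMType 24 1 6 17 ↔ -c ∉ fermatCMType 24 1 6 17))
      (A : AbelianVariety ℂ) (ι : 𝓞 L →+* End A) (θ : L →+* Module.End ℂ (complexBetti A.X 1)),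
      IsCMTypeRealisation (cmTypeOfResidues (L := L) (fermatCMType 24 1 6 17) hS) A ι θ ∧ A.dim = 4) ∧
    (∃ (hS : ∀ c : ZMod 24, c.val.Coprime 24 → (c ∈ fermatCMType 24 1 4 19 ↔ -c ∉ fermatCMType 24 1 4 19))
      (A : AbelianVariety ℂ) (ι : 𝓞 L →+* End A) (θ : L →+* Module.End ℂ (complexBetti A.X 1)),
      IsCMTypeRealisation (cmTypeOfResidues (L := L) (fermatCMType 24 1 4 19) hS) A ι θ ∧ A.dim = 4) ∧
    (∃ (hS : ∀ c : ZMod 24, c.val.Coprime 24 → (c ∈ fermatCMType 24 3 3 18 ↔ -c ∉ fermatCMType 24 3 3 18))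
      (A : AbelianVariety ℂ) (ι : 𝓞 L →+* End A) (θ : L →+* Module.End ℂ (complexBetti A.X 1)),
      IsCMTypeRealisation (cmTypeOfResidues (L := L) (fermatCMType 24 3 3 18) hS) A ι θ ∧ A.dim = 4) ∧
    (∃ (hS : ∀ c : ZMod 24, c.val.Coprime 24 → (c ∈ fermatCMType 24 1 2 21 ↔ -c ∉ fermatCMType 24 1 2 21))
      (A : AbelianVariety ℂ) (ι : 𝓞 L →+* End A) (θ : L →+* Module.End ℂ (complexBetti A.X 1)),
      IsCMTypeRealisation (cmTypeOfResidues (L := L) (fermatCMType 24 1 2 21) hS) A ι θ ∧ A.IsSimple ∧ A.dim = 4) := by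
  refine ⟨?_, ?_, ?_, ?_, ?_⟩
  · obtain ⟨hS, A, ι, θ, hA, hd⟩ := exists_isCMTypeRealisation_fermat (L := L) (M := 24) (by norm_num)
      (r := 1) (s := 1) (t := 22) (by decide) (by decide) (by decide) (by decide)
    exact ⟨hS, A, ι, θ, hA, by rw [hd]; decide⟩
  · obtain ⟨hS, A, ι, θ, hA, hd⟩ := exists_isCMTypeRealisation_fermat (L := L) (M := 24) (by norm_num)
      (r := 1) (s := 6) (t := 17) (by decide) (by decide) (by decide) (by decide)
    exact ⟨hS, A, ι, θ, hA, by rw [hd]; decide⟩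
  · obtain ⟨hS, A, ι, θ, hA, hd⟩ := exists_isCMTypeRealisation_fermat (L := L) (M := 24) (by norm_num)
      (r := 1) (s := 4) (t := 19) (by decide) (by decide) (by decide) (by decide)
    exact ⟨hS, A, ι, θ, hA, by rw [hd]; decide⟩
  · obtain ⟨hS, A, ι, θ, hA, hd⟩ := exists_isCMTypeRealisation_fermat (L := L) (M := 24) (by norm_num)
      (r := 3) (s := 3) (t := 18) (by decide) (by decide) (by decide) (by decide)
    exact ⟨hS, A, ι, θ, hA, by rw [hd]; decide⟩
  · obtain ⟨hS, A, ι, θ, hA, -⟩ := exists_isCMTypeRealisation_fermat (L := L) (M := 24) (by norm_num)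
      (r := 1) (s := 2) (t := 21) (by decide) (by decide) (by decide) (by decide)
    exact ⟨hS, A, ι, θ, hA, isSimple_fermat_twentyFour_of_mem (by rw [fermatCMType_twentyFour_simple_examples.1]; decide) hA⟩

end Varieties

end CyclotomicFermatCMType

end Literature.AlgebraicGeometry.ComplexMultiplication
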